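import Summits.ResolutionOfSingularities.ResolutionOfSingularities.Theorems.FrobeniusClosingSteerPersistentArcTelescope
import Summits.ResolutionOfSingularities.ResolutionOfSingularities.Theorems.FrobeniusClosingSteerSigmaTopLegalityConeDivisor
import HarnessLib

/-!
# Crux `Steer` (stmt-ResolutionOfSingularities-16345), chain W4.1 — RUNG programme for hG3, brick B6-core:
# THE PERSIST CONTRADICTION MODULO ITS FOUR ARC PACKAGES (arc prime with dual frame · order ring · p-th root · isolatedness upstairs)

OURS (campaign `res-hironaka`, rung L ★L-G4, slot W4.1; seat res-L0-w41-stub-1 g4, res-L0-w41-plan-1 RULING 119e; blueprint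
`L/res-L0-w41-stub-1/PERSIST-BLUEPRINT.md` 811204f015c0b400 §1 (L3′)–(L6)). Statements about the route's own objects; they
replace the role of no printed item and are NOT statements of the manuscript under review [claim: Hironaka2017, status:
under-review]; AI-produced, weaker than expert review. Theses-free, definition-free.

## The point

Everything the O-free persistence word `NoEternalPersistentChainPerfect p c d` (idea-3 Sketch-g5 §2) needs from COMPLETION
technology is isolated into four PACKAGES about one big regular local ring `T`, mapped into `F` by `ι` (in the application:
`T = Ŝ 0`, `F = Frac Ŝ 0`, `ι = algebraMap`, the chain transported into `F`):

* (Λ) an ideal `Λ = (y₁,…,y_n) ⊆ 𝔪_T` with `n < dim T` carrying DUAL derivations `D_i y_j = δ_ij` which extend to derivations of `F`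
  — the arc prime (blueprint B3a + B4 (E2));
* (𝒲) a subring `𝒲 ≤ F` containing `T` and every member `S m`, such that an element of `T` divisible in `𝒲` by every power
  of the persistent parameter `x` lies in `Λ` — the non-negative part of the arc order `ν = ord_x̄ ∘ π` (B5b);
* (√) an `h ∈ T` with `f 0 − h^p ∈ Λ` — the p-th root along the arc (B3b);
* (iso) `HasIsolatedSingularity (T[X]/(X^p − f 0))` — isolatedness carried up by excellence (B5c, tree
  `RadicandAscent.isolated_adicCompletion_of_isExcellentRing`).

**`false_of_arcPackages`**: given the packages and the chain data in `F` (the law with `d = p·e`, `e ≥ 1`; persistence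
`x m = u_m·x`; x-charts `t m` with `x/t m ∈ S (m+1)` and the `IsQuadraticTransform` fraction clause), FALSE. Mechanism: B2
telescope + derivation growth give `D_i (f 0) ∈ T ∩ ⋂_N x^N 𝒲 ⊆ Λ` for every `i` (`derivation_apply_mem_of_packages`); with (√),
conormal detection (B2 §3) puts `f 0 − h^p` in `Λ²`; idea-3's (CD0) `SigmaTopLegality.not_hasIsolatedSingularity_of_sub_pow_mem_sq_span`
(p529051) at `#gens = n < dim T` contradicts (iso). No valuation, no completion, no residue field appears here.
[cite: Matsumura1987, Thm. 14.2] [folklore]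
-/

noncomputable section

-- `Summit.<S>.<S>.…` duplicates the summit name by design (single-problem summit).
set_option linter.dupNamespace false
set_option autoImplicit false

namespace Summit.ResolutionOfSingularities.ResolutionOfSingularities.Theorems.SwitchingDichotomy.PersistentArc

open IsLocalRing
open Literature.AlgebraicGeometry.Resolution
open Summit.ResolutionOfSingularities.ResolutionOfSingularities.Theorems.SwitchingDichotomy.SigmaTopLegality

variable {F : Type} [Field F] (p : ℕ) [Fact p.Prime] [CharP F p]

/-- **Every package derivation kills `f 0` along the arc.** With the chain data in `F`, a subring `𝒲` containing all members,
and a derivation `D` of `F` with `D(S 0) ⊆ 𝒲`: `D (f 0) = x^N · w_N` with `w_N ∈ 𝒲` for EVERY `N` (telescope + growth: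
`D (f 0) = W_m^p · D (f m)`, `W_m = v·x^(m e)`, `x^m · D (f m) ∈ 𝒲`, and `m(pe − 1) ≥ N` for `m = N`). [folklore] -/
theorem exists_eq_pow_mul_of_growth (S : ℕ → Subring F) [∀ m, IsLocalRing (S m)] (hle : ∀ m, S m ≤ S (m + 1))
    (e : ℕ) (he : 1 ≤ e) (f g : ∀ m, S m) (xs : ∀ m, S (m + 1))
    (hlaw : ∀ m, ((f (m + 1) : S (m + 1)) : F) * ((xs m : S (m + 1)) : F) ^ (p * e)
      = ((f m : S m) : F) - ((g m : S m) : F) ^ p)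
    {x : F} (hux : ∀ i, ∃ u w : F, u ∈ S (i + 1) ∧ w ∈ S (i + 1) ∧ u * w = 1 ∧ ((xs i : S (i + 1)) : F) = u * x)
    (t : ℕ → F) (ht0 : ∀ m, t m ≠ 0) (htS : ∀ m, t m ∈ S m) (hxt : ∀ m, x / t m ∈ S (m + 1))
    (hbl : ∀ m, blowupRing (S m) (t m) ≤ S (m + 1))
    (hfrac : ∀ m, ∀ z ∈ S (m + 1), ∃ a ∈ blowupRing (S m) (t m), ∃ b ∈ blowupRing (S m) (t m),
      b⁻¹ ∈ S (m + 1) ∧ z = a / b)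
    (𝒲 : Subring F) (hSW : ∀ m, S m ≤ 𝒲) (D : Derivation ℤ F F) (hD : ∀ r ∈ S 0, D r ∈ 𝒲) (N : ℕ) :
    ∃ w ∈ 𝒲, D ((f 0 : S 0) : F) = x ^ N * w := by
  have hp2 : 2 ≤ p := (Fact.out : p.Prime).two_le
  -- growth: `x^N · D (f N) ∈ 𝒲`
  have hgrow := growth_tower D 𝒲 S hSW t ht0 htS (fun m => hSW (m + 1) (hxt m)) hbl hfrac hD N
    ((f N : S N) : F) (f N).2
  -- telescope at stage `N`
  obtain ⟨G, W, v, w, -, -, hv, -, -, hf, hW⟩ :=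
    exists_telescope_of_persistent p S hle f g xs e hlaw x hux N
  have hDf : D ((f 0 : S 0) : F) = W ^ p * D ((f N : S N) : F) := derivation_eq_of_telescope p D hf
  -- exponent bookkeeping: `N·e·p = N + (N·(e·p − 1))`, and `N·(e·p − 1) ≥ N`
  obtain ⟨k, hk⟩ : ∃ k, N * e * p = N + N + k := by
    have : 2 * N ≤ N * e * p := by
      calc 2 * N = N * 1 * 2 := by ring
        _ ≤ N * e * p := Nat.mul_le_mul (Nat.mul_le_mul le_rfl he) hp2
    exact ⟨N * e * p - 2 * N, by omega⟩
  refine ⟨x ^ k * (v ^ p * (x ^ N * D ((f N : S N) : F))),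
    𝒲.mul_mem (𝒲.pow_mem ?_ k) (𝒲.mul_mem (𝒲.pow_mem (hSW N hv) p) hgrow), ?_⟩
  · -- `x ∈ S 1 ≤ 𝒲`: `x = w₀ · xs 0`
    obtain ⟨u, w₀, -, hw₀, huw, hx⟩ := hux 0
    have : x = w₀ * ((xs 0 : S 1) : F) := by
      rw [hx, ← mul_assoc, mul_comm w₀ u, huw, one_mul]
    rw [this]
    exact hSW 1 ((S 1).mul_mem hw₀ (xs 0).2)
  · rw [hDf, hW, mul_pow, ← pow_mul, hk]; ring

/-- **(CD0), abstract form** of idea-3's `SigmaTopLegality.not_hasIsolatedSingularity_of_sub_pow_mem_sq_span` (p529051, stated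
there for members `R : Subring K`; the proof is the same and uses only the ring): on a regular local ring `T` of characteristic
`p` and dimension `c`, `f − h^p ∈ (span Tf)²` for a finite `Tf ⊆ 𝔪` with `#Tf < c` makes `T[X]/(X^p − f)` NON-isolated.
[cite: Matsumura1987, Thm. 14.2] -/
theorem not_hasIsolatedSingularity_of_sub_pow_mem_sq_span' {T : Type} [CommRing T] [IsRegularLocalRing T] [CharP T p]
    (f h : T) (Tf : Finset T) (hT : ∀ t ∈ Tf, t ∈ maximalIdeal T) (hf : f - h ^ p ∈ Ideal.span (Tf : Set T) ^ 2)
    {c : ℕ} (hcard : Tf.card < c) (hdim : ringKrullDim T = c) : ¬ HasIsolatedSingularity (RadicandRing T p f) := by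
  intro hiso
  have hle : Ideal.span (Tf : Set T) ≤ maximalIdeal T :=
    Ideal.span_le.mpr (fun t ht => hT t (by exact_mod_cast ht))
  obtain ⟨Q, hQ, -⟩ := Ideal.exists_minimalPrimes_le hle
  haveI : Q.IsPrime := hQ.1.1
  have hQh : Q.height ≤ Tf.card := Ideal.height_le_card_of_mem_minimalPrimes_span_finset hQ
  have hne : Q ≠ maximalIdeal T := by
    intro hQm
    rw [hQm] at hQh
    have hm : ((maximalIdeal T).height : WithBot ℕ∞) = ((c : ℕ∞) : WithBot ℕ∞) := by
      rw [IsLocalRing.maximalIdeal_height_eq_ringKrullDim, hdim]; rfl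
    have hm' : (maximalIdeal T).height = (c : ℕ∞) := WithBot.coe_injective hm
    rw [hm'] at hQh
    have : c ≤ Tf.card := by exact_mod_cast hQh
    omega
  have hnotmax : ¬ Q.IsMaximal := fun hm => hne (IsLocalRing.eq_maximalIdeal hm)
  have hfQ : f - h ^ p ∈ Q ^ 2 := Ideal.pow_right_mono hQ.1.2 2 hf
  haveI : IsRegularRing T := isRegularRing_of_isRegularLocalRing T
  haveI : IsDomain T := isDomain_of_isRegularLocalRing T
  obtain ⟨P', hP', hlt, hreg⟩ :=
    RadicandChain.exists_nonmaximal_not_isRegularLocalRing_of_sub_pow_mem_sq (S := T) p f h Q hnotmax hfQ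
  exact hreg (hiso P' hlt)

/-- **The PERSIST contradiction modulo the arc packages** (blueprint (L3′)+(L5)+(L6)), for an ABSTRACT regular local `T`
mapped into the field `F` by `ι` (in the application `T = Ŝ 0`, `F = Frac Ŝ 0`, `ι = algebraMap`). See the module docstring
for the four packages (Λ with dual frame, 𝒲, √, iso). [cite: Matsumura1987, Thm. 14.2] -/
theorem false_of_arcPackages
    -- the big regular ring and its map to `F`
    (T : Type) [CommRing T] [IsRegularLocalRing T] [CharP T p] {c : ℕ} (hdimT : ringKrullDim T = c) (ι : T →+* F)
    -- the chain, transported into `F`, starting inside the image of `T`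
    (S : ℕ → Subring F) [∀ m, IsLocalRing (S m)] (hle : ∀ m, S m ≤ S (m + 1)) (hS0 : ∀ r ∈ S 0, ∃ a : T, ι a = r)
    (e : ℕ) (he : 1 ≤ e) (f g : ∀ m, S m) (xs : ∀ m, S (m + 1))
    (hlaw : ∀ m, ((f (m + 1) : S (m + 1)) : F) * ((xs m : S (m + 1)) : F) ^ (p * e)
      = ((f m : S m) : F) - ((g m : S m) : F) ^ p)
    (f₀ : T) (hf₀ : ι f₀ = ((f 0 : S 0) : F))
    {x : F} (hux : ∀ i, ∃ u w : F, u ∈ S (i + 1) ∧ w ∈ S (i + 1) ∧ u * w = 1 ∧ ((xs i : S (i + 1)) : F) = u * x)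
    (t : ℕ → F) (ht0 : ∀ m, t m ≠ 0) (htS : ∀ m, t m ∈ S m) (hxt : ∀ m, x / t m ∈ S (m + 1))
    (hbl : ∀ m, blowupRing (S m) (t m) ≤ S (m + 1))
    (hfrac : ∀ m, ∀ z ∈ S (m + 1), ∃ a ∈ blowupRing (S m) (t m), ∃ b ∈ blowupRing (S m) (t m),
      b⁻¹ ∈ S (m + 1) ∧ z = a / b)
    -- (Λ) the arc prime `(y₁,…,y_n)`, `n < c`, with dual derivations extending to `F`
    {n : ℕ} (hn : n < c) (y : Fin n → T) (hy : ∀ j, y j ∈ maximalIdeal T)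
    (D : Fin n → Derivation ℤ T T) (hD : ∀ i j, D i (y j) = if i = j then 1 else 0)
    (Dext : Fin n → Derivation ℤ F F) (hDext : ∀ i (a : T), Dext i (ι a) = ι (D i a))
    -- (𝒲) the order ring
    (𝒲 : Subring F) (hTW : ∀ a : T, ι a ∈ 𝒲) (hSW : ∀ m, S m ≤ 𝒲)
    (hΛ𝒲 : ∀ z : T, (∀ N : ℕ, ∃ w ∈ 𝒲, ι z = x ^ N * w) → z ∈ Ideal.span (Set.range y))
    -- (√) the p-th root along the arc
    (hroot : ∃ h : T, f₀ - h ^ p ∈ Ideal.span (Set.range y))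
    -- (iso) isolatedness upstairs
    (hiso : HasIsolatedSingularity (RadicandRing T p f₀)) : False := by
  classical
  obtain ⟨h, hh⟩ := hroot
  -- every `D i` kills `f 0` along the arc
  have hDf : ∀ i, D i f₀ ∈ Ideal.span (Set.range y) := by
    intro i
    refine hΛ𝒲 _ fun N => ?_
    obtain ⟨w, hw, hDw⟩ := exists_eq_pow_mul_of_growth p S hle e he f g xs hlaw hux t ht0 htS hxt hbl hfrac 𝒲 hSW
      (Dext i) (fun r hr => by
        obtain ⟨a, rfl⟩ := hS0 r hr
        rw [hDext]; exact hTW _) N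
    exact ⟨w, hw, by rw [← hDext, hf₀]; exact hDw⟩
  -- hence `D i (f₀ − h^p) ∈ Λ`
  have hDu : ∀ i, D i (f₀ - h ^ p) ∈ Ideal.span (Set.range y) := by
    intro i
    have : D i (f₀ - h ^ p) = D i f₀ := by
      rw [map_sub, (D i).leibniz_pow, ← Nat.cast_smul_eq_nsmul T p, CharP.cast_eq_zero T p, zero_smul, sub_zero]
    rw [this]; exact hDf i
  -- conormal detection: `f₀ − h^p ∈ Λ²`
  have hsq : f₀ - h ^ p ∈ Ideal.span (Set.range y) ^ 2 := mem_sq_of_forall_derivation_mem y D hD hh hDu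
  -- (CD0) with the finite generating set `{y j}`
  have hspan : Ideal.span ((Finset.univ.image y : Finset T) : Set T) = Ideal.span (Set.range y) := by
    rw [Finset.coe_image, Finset.coe_univ, Set.image_univ]
  refine not_hasIsolatedSingularity_of_sub_pow_mem_sq_span' p f₀ h (Finset.univ.image y) ?_ ?_ ?_ hdimT hiso
  · intro s hs
    obtain ⟨j, -, rfl⟩ := Finset.mem_image.mp hs
    exact hy j
  · rw [hspan]; exact hsq
  · calc (Finset.univ.image y).card ≤ (Finset.univ : Finset (Fin n)).card := Finset.card_image_le
      _ = n := Finset.card_fin n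
      _ < c := hn

end Summit.ResolutionOfSingularities.ResolutionOfSingularities.Theorems.SwitchingDichotomy.PersistentArc

end
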